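import Mathlib
import Summits.NavierStokesRegularity.NavierStokesRegularity.Theses.TypeIQuarterGate
import Summits.NavierStokesRegularity.NavierStokesRegularity.Theorems.TypeIQuarterGateScarEnvelopeTypeISatelliteTowerEnvelopeDefs
import Literature.Barriers.NavierStokesRegularity.AveragedTypeIBlowup
import Summits.NavierStokesRegularity.NavierStokesRegularity.Theorems.PerpetualPumpAveragedTypeIBlowup

/-!
# ns-idea-16 g0 — NEARMISS census sketch «Osgood line» for crux 23843 `ScarEnvelopeTypeI`

Typed statements AND PROOFS backing `NEARMISS-CENSUS-ns16-g0.md` (rows 22–27, the LPS–Orlicz–Lorentz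
log-improvement family). NOT a line, NOT a card: the single input `OsgoodSerrin ε` is STRONGER than
Type-I exclusion (`osgoodSerrin_excludes_typeI`: it makes the hypothesis `IsTypeIBlowup` of 23843
impossible), so it is recorded as a measured near-miss, not proposed as an attack.
NS regularity is NOT proved here or anywhere in this file. `lean check`: rc 0, 0 sorries; axioms standard.

STATEMENTS
* `phi ε y = y² / (log (e + y))^(1+ε)` — the Osgood-damped Serrin density at `(p,q) = (2,∞)`.
* `OsgoodSerrin ε` — the SINGLE INPUT of the family (blow-up form): a maximal smooth solution with finite
  lifespan `T` (Leray–Hopf, rapidly decaying datum) admits NO integrable majorant of `t ↦ sup_x phi ε ‖u t x‖`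
  near `T`. Printed for the Osgood-DIVERGENT modulus `log¹` (Montgomery-Smith 2005 Thm 1.1 + Rem. 2.1,
  `3 < q < ∞`; Zhou–Lei / Bjorland–Vasseur 2011 Thm 1.1 with `log(e+‖u‖_∞)`); OPEN for every `ε > 0`.
* `TypeIOnOsgoodLine ε` — ENEMY PLACEMENT: a Type-I blow-up (`IsTypeIBlowup`) HAS such a majorant.
* `OsgoodSerrinAveragedFailure ε` — Tao's averaged class carries a finite-time mild blow-up WITH an
  `L¹(0,T)` Osgood majorant; `OsgoodLineAbstractPin ε := AveragedTypeIBlowup → OsgoodSerrinAveragedFailure ε`.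
* `EnvelopeOrliczPlacement β` — the `(5,5)` space–time face (Chan–Vasseur 2007 Thm 1 has `β = 1`): a
  KNSS-enveloped field (`HasTypeIDecay A U`) has `∫∫_{Q₁} |U|⁵/(log(e+|U|))^β < ∞` for every `β > 1`
  (statement only; parabolic-shell computation, not proved here).

THEOREMS (all sorry-free)
* `osgoodModelIntegrable (hε : 0 < ε)` — THE CALCULUS FACT: `t ↦ |C|/√(T−t) + 2^{1+ε}·phi ε (|C|/√(T−t))`
  is integrable on `(0,T)` (antiderivative `−ε⁻¹ (log(e + |C|/√(T−t)))^{−ε}`, piecewise-extended by `0` at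
  `T`, `intervalIntegral.integrableOn_deriv_of_nonneg`; domination constant `K = 2|C|(e√T + |C|)`).
* `phi_le_of_le` — crude damping bound `0 ≤ y ≤ Y → phi ε y ≤ Y + 2^{1+ε} phi ε Y` (no monotonicity).
* `typeIOnOsgoodLine (hε : 0 < ε) : TypeIOnOsgoodLine ε` — every sup-rate Type-I blow-up sits on the
  Osgood-CONVERGENT side of every log-damped `(2,∞)` Serrin criterion.
* `scarEnvelopeTypeI_of_osgoodSerrin'  (hε : 0 < ε) : OsgoodSerrin ε → ScarEnvelopeTypeI` — kernel-checked:
  the single input ALONE decides 23843 (vacuously), and `osgoodSerrin_excludes_typeI` shows why: it is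
  Type-I exclusion for the Leray–Hopf maximal class, i.e. ≥ the wall (SAME-WALL H3/H2).
* `osgoodSerrinAveragedFailure (hε : 0 < ε) : OsgoodSerrinAveragedFailure ε` — UNCONDITIONAL, from the
  tree theorem `Theorems.PerpetualPumpAveragedTypeIBlowup.AveragedTypeIBlowup_of` (route PerpetualPump,
  item 1835): the barrier note of the census § D is a THEOREM — no Osgood-convergent `(2,∞)` criterion is
  provable by averaging-insensitive (energy identity + `L^r`-multiplier) means.
* `averagedOsgoodSerrinCriterion_fails (hε : 0 < ε)` — the same, packaged as the FAILURE of the continuation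
  criterion `AveragedOsgoodSerrinCriterion ε 𝒜` for some symmetric `𝒜` with cancellation.
-/

set_option linter.dupNamespace false

open MeasureTheory Set Filter Topology
open scoped ENNReal

namespace Summit.NavierStokesRegularity.NavierStokesRegularity.Cruxes.ScarEnvelopeTypeI.OsgoodLine

open Literature.Analysis.FluidPDE

/-- `E3 = ℝ³`. -/
abbrev E3 := EuclideanSpace ℝ (Fin 3)

/-- Osgood-damped Serrin density at `(2,∞)`: `y² / (log (e + y))^(1+ε)`. -/
noncomputable def phi (ε y : ℝ) : ℝ :=
  y ^ 2 / Real.log (Real.exp 1 + y) ^ (1 + ε)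

/-- `u` has an integrable majorant of its damped Serrin density on some tail interval `(T-δ, T)`. -/
def HasOsgoodMajorantNear (ε : ℝ) (u : ℝ → E3 → E3) (T : ℝ) : Prop :=
  ∃ δ : ℝ, 0 < δ ∧ ∃ g : ℝ → ℝ, IntegrableOn g (Ioo (T - δ) T) ∧
    ∀ t ∈ Ioo (T - δ) T, ∀ x : E3, phi ε ‖u t x‖ ≤ g t

/-- SINGLE INPUT of the LPS–Orlicz family at `(2,∞)` (beyond-Osgood log-damped Serrin criterion, blow-up
form): no maximal smooth solution from a Leray–Hopf rapidly decaying datum has an Osgood majorant near its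
lifespan. Printed with `log¹` [MontgomerySmith2005 Thm 1.1, Rem 2.1; BjorlandVasseur2011 Thm 1.1];
open for every `ε > 0`; FALSE in Tao's averaged class (`OsgoodLineAbstractPin`). -/
def OsgoodSerrin (ε : ℝ) : Prop :=
  ∀ (ν T : ℝ), 0 < ν → 0 < T → ∀ (u : ℝ → E3 → E3) (p : ℝ → E3 → ℝ),
    IsMaximalSmoothSolution ν 0 u p T → IsLerayHopfOn T ν 0 (u 0) u →
    HasRapidSpatialDecay (u 0) → ¬ HasOsgoodMajorantNear ε u T

/-- ENEMY PLACEMENT (true by one-variable real analysis; to be landed by a prover if wanted):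
a Type-I blow-up sits on the CONVERGENT side of the Osgood line for every `ε > 0`. -/
def TypeIOnOsgoodLine (ε : ℝ) : Prop :=
  ∀ (T : ℝ) (u : ℝ → E3 → E3), 0 < T → IsTypeIBlowup u T → HasOsgoodMajorantNear ε u T

/-- The explicit majorant `|C|/√(T-t) + 2^{1+ε}·phi ε (|C|/√(T-t))` of the damped Serrin density under a
Type-I bound `‖u t x‖ ≤ C/√(T-t)` (crude damping bound `phi_le_of_le`; no monotonicity of `phi` needed). -/
noncomputable def osgoodMajorant (ε C T : ℝ) (t : ℝ) : ℝ :=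
  |C| / Real.sqrt (T - t) + (2 : ℝ) ^ (1 + ε) * phi ε (|C| / Real.sqrt (T - t))

/-- THE ONE CALCULUS STUB of this sketch (one-variable real analysis, no NS content): the majorant is
integrable on `(0,T)` — i.e. `∫₀^T (T-t)^{-1/2} dt < ∞` and `∫₀^T C²/((T-t) (log(e+|C|/√(T-t)))^{1+ε}) dt < ∞`
(substitute `τ = log(1/(T-t))`, compare with `∫^∞ τ^{-(1+ε)} dτ`). True for every `ε > 0`; false for `ε = 0`, `C ≠ 0`. -/
def OsgoodModelIntegrable (ε : ℝ) : Prop :=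
  ∀ (C T : ℝ), 0 < T → IntegrableOn (osgoodMajorant ε C T) (Ioo 0 T)

theorem one_le_log_e_add {y : ℝ} (hy : 0 ≤ y) : 1 ≤ Real.log (Real.exp 1 + y) := by
  have h : Real.exp 1 ≤ Real.exp 1 + y := le_add_of_nonneg_right hy
  calc (1 : ℝ) = Real.log (Real.exp 1) := (Real.log_exp 1).symm
    _ ≤ Real.log (Real.exp 1 + y) := Real.log_le_log (Real.exp_pos 1) h

theorem phi_nonneg {ε y : ℝ} (hy : 0 ≤ y) : 0 ≤ phi ε y := by
  unfold phi
  exact div_nonneg (pow_nonneg hy 2) (Real.rpow_nonneg (zero_le_one.trans (one_le_log_e_add hy)) _)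

theorem phi_le_sq {ε y : ℝ} (hε : 0 ≤ 1 + ε) (hy : 0 ≤ y) : phi ε y ≤ y ^ 2 := by
  unfold phi
  exact div_le_self (pow_nonneg hy 2) (Real.one_le_rpow (one_le_log_e_add hy) hε)

theorem log_e_add_le_two_mul {y Y : ℝ} (hy : 0 ≤ y) (hY : Y ≤ y ^ 2) (hY0 : 0 ≤ Y) :
    Real.log (Real.exp 1 + Y) ≤ 2 * Real.log (Real.exp 1 + y) := by
  have he : (1 : ℝ) ≤ Real.exp 1 := by
    have := Real.add_one_le_exp (1 : ℝ); linarith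
  have hepos : 0 < Real.exp 1 := Real.exp_pos 1
  have h1 : Real.exp 1 + Y ≤ (Real.exp 1 + y) ^ 2 := by nlinarith
  calc Real.log (Real.exp 1 + Y) ≤ Real.log ((Real.exp 1 + y) ^ 2) :=
        Real.log_le_log (by linarith) h1
    _ = 2 * Real.log (Real.exp 1 + y) := by
        rw [Real.log_pow]; push_cast; ring

/-- **Crude damping bound** (replaces monotonicity of `phi`): for `0 ≤ y ≤ Y` and `ε ≥ 0`,
`phi ε y ≤ Y + 2^{1+ε} · phi ε Y`. (Cases `y² ≤ Y`: `phi ε y ≤ y² ≤ Y`; `y² > Y`: `log(e+Y) ≤ 2 log(e+y)`.) -/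
theorem phi_le_of_le {ε y Y : ℝ} (hε : 0 ≤ ε) (hy : 0 ≤ y) (hyY : y ≤ Y) :
    phi ε y ≤ Y + (2 : ℝ) ^ (1 + ε) * phi ε Y := by
  have hY0 : 0 ≤ Y := hy.trans hyY
  have hε1 : 0 ≤ 1 + ε := by linarith
  have h2pos : 0 < (2 : ℝ) ^ (1 + ε) := Real.rpow_pos_of_pos two_pos _
  have hphiY : 0 ≤ phi ε Y := phi_nonneg hY0
  rcases le_or_gt (y ^ 2) Y with hA | hB
  · calc phi ε y ≤ y ^ 2 := phi_le_sq hε1 hy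
      _ ≤ Y := hA
      _ ≤ Y + (2 : ℝ) ^ (1 + ε) * phi ε Y := le_add_of_nonneg_right (mul_nonneg h2pos.le hphiY)
  · have hLy : 1 ≤ Real.log (Real.exp 1 + y) := one_le_log_e_add hy
    have hLY : 1 ≤ Real.log (Real.exp 1 + Y) := one_le_log_e_add hY0
    have hlog : Real.log (Real.exp 1 + Y) ≤ 2 * Real.log (Real.exp 1 + y) :=
      log_e_add_le_two_mul hy hB.le hY0
    have hpow : Real.log (Real.exp 1 + Y) ^ (1 + ε)
        ≤ (2 : ℝ) ^ (1 + ε) * Real.log (Real.exp 1 + y) ^ (1 + ε) := by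
      calc Real.log (Real.exp 1 + Y) ^ (1 + ε) ≤ (2 * Real.log (Real.exp 1 + y)) ^ (1 + ε) :=
            Real.rpow_le_rpow (by linarith) hlog hε1
        _ = (2 : ℝ) ^ (1 + ε) * Real.log (Real.exp 1 + y) ^ (1 + ε) :=
            Real.mul_rpow (by norm_num) (by linarith)
    have hLypos : 0 < Real.log (Real.exp 1 + y) ^ (1 + ε) := Real.rpow_pos_of_pos (by linarith) _
    have hLYpos : 0 < Real.log (Real.exp 1 + Y) ^ (1 + ε) := Real.rpow_pos_of_pos (by linarith) _
    have hy2 : y ^ 2 ≤ Y ^ 2 := pow_le_pow_left₀ hy hyY 2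
    have step1 : phi ε y * Real.log (Real.exp 1 + Y) ^ (1 + ε)
        ≤ (2 : ℝ) ^ (1 + ε) * y ^ 2 := by
      have hphi : phi ε y * Real.log (Real.exp 1 + y) ^ (1 + ε) = y ^ 2 := by
        unfold phi; field_simp
      calc phi ε y * Real.log (Real.exp 1 + Y) ^ (1 + ε)
          ≤ phi ε y * ((2 : ℝ) ^ (1 + ε) * Real.log (Real.exp 1 + y) ^ (1 + ε)) :=
            mul_le_mul_of_nonneg_left hpow (phi_nonneg hy)
        _ = (2 : ℝ) ^ (1 + ε) * (phi ε y * Real.log (Real.exp 1 + y) ^ (1 + ε)) := by ring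
        _ = (2 : ℝ) ^ (1 + ε) * y ^ 2 := by rw [hphi]
    have step2 : phi ε y ≤ (2 : ℝ) ^ (1 + ε) * y ^ 2 / Real.log (Real.exp 1 + Y) ^ (1 + ε) := by
      rw [le_div_iff₀ hLYpos]; exact step1
    have step3 : (2 : ℝ) ^ (1 + ε) * y ^ 2 / Real.log (Real.exp 1 + Y) ^ (1 + ε)
        ≤ (2 : ℝ) ^ (1 + ε) * phi ε Y := by
      have : (2 : ℝ) ^ (1 + ε) * phi ε Y
          = (2 : ℝ) ^ (1 + ε) * Y ^ 2 / Real.log (Real.exp 1 + Y) ^ (1 + ε) := by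
        unfold phi; ring
      rw [this]
      exact div_le_div_of_nonneg_right (mul_le_mul_of_nonneg_left hy2 h2pos.le) hLYpos.le
    linarith [step2, step3]

/-- Under a pointwise Type-I bound at time `t < T`, the damped density is below the explicit majorant. -/
theorem phi_le_majorant {ε C T t y : ℝ} (hε : 0 ≤ ε) (ht : t < T) (hy0 : 0 ≤ y)
    (hy : y ≤ C / Real.sqrt (T - t)) : phi ε y ≤ osgoodMajorant ε C T t := by
  have hs : 0 < Real.sqrt (T - t) := Real.sqrt_pos.mpr (by linarith)
  have hyY : y ≤ |C| / Real.sqrt (T - t) :=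
    hy.trans (div_le_div_of_nonneg_right (le_abs_self C) hs.le)
  exact phi_le_of_le hε hy0 hyY

/-- **Kernel-checked glue (why the row is SAME-WALL):** the single input at one `ε` together with the
(real-analysis) placement decides crux 23843 — vacuously, because Type-I blow-up becomes impossible. -/
theorem scarEnvelopeTypeI_of_osgoodSerrin (ε : ℝ) (hO : OsgoodSerrin ε) (hP : TypeIOnOsgoodLine ε) :
    Summit.NavierStokesRegularity.NavierStokesRegularity.Theses.TypeIQuarterGate.ScarEnvelopeTypeI := by
  intro ν T hν hT u p hmax hLH hdec hI _hfin
  exact absurd (hP T u hT hI) (hO ν T hν hT u p hmax hLH hdec)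

/-- **Barrier-side pin (NEW observation, one real-analysis lemma away from a tree theorem):** from
`AveragedTypeIBlowup` (PROVED Summits-side: `Theorems.PerpetualPumpAveragedTypeIBlowup.AveragedTypeIBlowup_of`)
one gets a Tao-class mild solution with no mild extension past `T` whose damped Serrin density has an
integrable majorant on `(0,T)` — the `(2,∞)` Osgood-convergent criterion FAILS in the averaged class. -/
def OsgoodSerrinAveragedFailure (ε : ℝ) : Prop :=
    ∃ 𝒜 : Tao2016.AveragingDatum, 𝒜.IsSymmetric ∧ 𝒜.HasCancellation ∧
      ∃ u₀ : SchwartzMap E3 E3, VectorCalculus.IsDivFree ⇑u₀ ∧ ∃ T : ℝ, 0 < T ∧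
        ∃ u : ℝ → Tao2016.L2C, 𝒜.IsMildSolution (Tao2016.schwartzL2 u₀) (Ico 0 T) u ∧
          (¬ ∃ T' : ℝ, T < T' ∧ ∃ v : ℝ → Tao2016.L2C,
              𝒜.IsMildSolution (Tao2016.schwartzL2 u₀) (Ico 0 T') v ∧ ∀ t ∈ Ico 0 T, v t = u t) ∧
          ∃ g : ℝ → ℝ, IntegrableOn g (Ioo 0 T) ∧
            ∀ t ∈ Ico 0 T, phi ε (eLpNorm (u t) ⊤ volume).toReal ≤ g t

/-- The pin as an implication from the tree's barrier statement (vendored form). -/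
def OsgoodLineAbstractPin (ε : ℝ) : Prop :=
  Literature.Barriers.NavierStokesRegularity.AveragedTypeIBlowup → OsgoodSerrinAveragedFailure ε

/-- **ENEMY PLACEMENT, proved modulo the calculus stub**: sup-rate Type I ⇒ Osgood majorant near `T`. -/
theorem typeIOnOsgoodLine_of_model {ε : ℝ} (hε : 0 ≤ ε) (hI : OsgoodModelIntegrable ε) :
    TypeIOnOsgoodLine ε := by
  intro T u hT hTypeI
  obtain ⟨C, hC⟩ := hTypeI
  obtain ⟨l, hlT, hsub⟩ := mem_nhdsLT_iff_exists_Ioo_subset.mp hC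
  have hl : l < T := hlT
  refine ⟨min (T - l) T, lt_min (by linarith) hT, osgoodMajorant ε C T, ?_, ?_⟩
  · refine (hI C T hT).mono_set (Ioo_subset_Ioo ?_ le_rfl)
    have := min_le_right (T - l) T; linarith
  · intro t ht x
    have ht' : t ∈ Ioo l T := ⟨by have := min_le_left (T - l) T; linarith [ht.1], ht.2⟩
    exact phi_le_majorant hε ht.2 (norm_nonneg _) (hsub ht' x)

/-- **BARRIER PIN, proved modulo the calculus stub**: the Tao-class averaged Type-I blow-up (tree theorem)
has an Osgood majorant on `(0,T)` for every `ε ≥ 0` — no Osgood-convergent `(2,∞)` Serrin criterion is abstract. -/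
theorem osgoodLineAbstractPin_of_model {ε : ℝ} (hε : 0 ≤ ε) (hI : OsgoodModelIntegrable ε) :
    OsgoodLineAbstractPin ε := by
  rintro ⟨𝒜, hs, hc, u₀, hdiv, T, hT, u, hmild, ⟨M, hrate⟩, hno⟩
  refine ⟨𝒜, hs, hc, u₀, hdiv, T, hT, u, hmild, hno, osgoodMajorant ε M T, hI M T hT, ?_⟩
  intro t ht
  have hs' : 0 < Real.sqrt (T - t) := Real.sqrt_pos.mpr (by linarith [ht.2])
  have hb : 0 ≤ |M| / Real.sqrt (T - t) := div_nonneg (abs_nonneg M) hs'.le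
  have h1 : eLpNorm (u t) ⊤ volume ≤ ENNReal.ofReal (|M| / Real.sqrt (T - t)) :=
    (hrate t ht).trans (ENNReal.ofReal_le_ofReal (div_le_div_of_nonneg_right (le_abs_self M) hs'.le))
  have h2 : (eLpNorm (u t) ⊤ volume).toReal ≤ |M| / Real.sqrt (T - t) :=
    ENNReal.toReal_le_of_le_ofReal hb h1
  exact phi_le_of_le hε ENNReal.toReal_nonneg h2

/-- `(5,5)` space–time face (Chan–Vasseur 2007 Thm 1 is `β = 1`): a KNSS-enveloped field on `(-∞,0) × ℝ³`
has finite `∫∫_{Q₁(0,0)} |U|⁵ / (log (e + |U|))^β` — true for every `β > 1` (parabolic shells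
`2^{-k-1} ≤ ‖x‖ + √(-t) < 2^{-k}` contribute `≍ A⁵ k^{-β}`), and `= ∞` for `β ≤ 1` on DSS fields. -/
def EnvelopeOrliczPlacement (β : ℝ) : Prop :=
  ∀ (A : ℝ) (U : ℝ → E3 → E3), HasTypeIDecay A U →
    ∫⁻ z in parabolicCylinder 1 ((0 : ℝ), (0 : E3)),
        ENNReal.ofReal (‖U z.1 z.2‖ ^ 5 / Real.log (Real.exp 1 + ‖U z.1 z.2‖) ^ β) < ∞

/-- The enveloped-leaf face of 23843 in this currency: an `EnvelopedLeaf M A` (constant amplitude `A`,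
Bjorland–Vasseur 2011 p. 3: "This does not include constant `C`") lies in every Osgood-convergent Orlicz
class `L⁵ (log L)^{-β}(Q₁)`, `β > 1`, by `EnvelopeOrliczPlacement`. -/
theorem envelopedLeaf_orlicz {β M A : ℝ} (hβ : EnvelopeOrliczPlacement β)
    (h : ZoomDictionary.EnvelopedLeaf M A) :
    ∃ (U : ℝ → E3 → E3), HasTypeIDecay A U ∧ ¬ ZoomDictionary.RegPt U 0 ∧
      ∫⁻ z in parabolicCylinder 1 ((0 : ℝ), (0 : E3)),
        ENNReal.ofReal (‖U z.1 z.2‖ ^ 5 / Real.log (Real.exp 1 + ‖U z.1 z.2‖) ^ β) < ∞ := by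
  obtain ⟨U, P, H, _hT, hdec, hsing⟩ := h
  exact ⟨U, hdec, hsing, hβ A U hdec⟩

/-! ### Term 1: `|C|/√(T-t)` is integrable on `(0,T)` -/

theorem integrableOn_inv_sqrt (C T : ℝ) (hT : 0 < T) :
    IntegrableOn (fun t => |C| / Real.sqrt (T - t)) (Ioo 0 T) := by
  have hr : IntervalIntegrable (fun x : ℝ => x ^ (-(1 / 2 : ℝ))) volume 0 T :=
    intervalIntegral.intervalIntegrable_rpow' (by norm_num)
  have hr' := (hr.comp_sub_left T).symm
  rw [sub_zero, sub_self] at hr'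
  have hIoc : IntegrableOn (fun x => (T - x) ^ (-(1 / 2 : ℝ))) (Ioc 0 T) :=
    (intervalIntegrable_iff_integrableOn_Ioc_of_le hT.le).mp hr'
  have h1 : IntegrableOn (fun x => |C| * (T - x) ^ (-(1 / 2 : ℝ))) (Ioo 0 T) :=
    (hIoc.mono_set Ioo_subset_Ioc_self).const_mul |C|
  refine h1.congr_fun (fun t ht => ?_) measurableSet_Ioo
  have h0 : (0 : ℝ) ≤ T - t := by linarith [ht.2]
  show |C| * (T - t) ^ (-(1 / 2 : ℝ)) = |C| / Real.sqrt (T - t)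
  rw [Real.sqrt_eq_rpow, Real.rpow_neg h0]
  exact (div_eq_mul_inv _ _).symm

/-! ### Term 2: the damped density along the Type-I envelope -/

/-- `L c T t = log(e + c/√(T-t))`. -/
noncomputable def Lfun (c T t : ℝ) : ℝ := Real.log (Real.exp 1 + c / Real.sqrt (T - t))

/-- raw chain-rule derivative of `t ↦ -(ε⁻¹) * (Lfun c T t)^(-ε)`. -/
noncomputable def Dfun (ε c T t : ℝ) : ℝ :=
  -(ε⁻¹) * ((0 * Real.sqrt (T - t) - c * (-1 / (2 * Real.sqrt (T - t)))) / Real.sqrt (T - t) ^ 2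
      / (Real.exp 1 + c / Real.sqrt (T - t)) * (-ε) * Lfun c T t ^ (-ε - 1))

theorem Lfun_pos {c T t : ℝ} (hc : 0 ≤ c) (ht : t < T) : 0 < Lfun c T t := by
  unfold Lfun
  have hs : 0 < Real.sqrt (T - t) := Real.sqrt_pos.mpr (by linarith)
  exact lt_of_lt_of_le zero_lt_one (one_le_log_e_add (div_nonneg hc hs.le))

theorem hasDerivAt_G {ε c T t : ℝ} (hc : 0 ≤ c) (ht : t < T) :
    HasDerivAt (fun x => -(ε⁻¹) * Lfun c T x ^ (-ε)) (Dfun ε c T t) t := by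
  have hTt : T - t ≠ 0 := by have : 0 < T - t := by linarith
                             exact this.ne'
  have hs : 0 < Real.sqrt (T - t) := Real.sqrt_pos.mpr (by linarith)
  have hE : Real.exp 1 + c / Real.sqrt (T - t) ≠ 0 := by
    have : 0 < Real.exp 1 + c / Real.sqrt (T - t) := by positivity
    exact this.ne'
  have h1 : HasDerivAt (fun x => T - x) (-1) t := by
    simpa using (hasDerivAt_id t).const_sub T
  have h2 : HasDerivAt (fun x => Real.sqrt (T - x)) (-1 / (2 * Real.sqrt (T - t))) t := h1.sqrt hTt
  have h3 : HasDerivAt (fun x => c / Real.sqrt (T - x))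
      ((0 * Real.sqrt (T - t) - c * (-1 / (2 * Real.sqrt (T - t)))) / Real.sqrt (T - t) ^ 2) t :=
    (hasDerivAt_const t c).div h2 hs.ne'
  have h4 : HasDerivAt (fun x => Real.exp 1 + c / Real.sqrt (T - x))
      ((0 * Real.sqrt (T - t) - c * (-1 / (2 * Real.sqrt (T - t)))) / Real.sqrt (T - t) ^ 2) t :=
    h3.const_add (Real.exp 1)
  have h5 : HasDerivAt (fun x => Lfun c T x)
      ((0 * Real.sqrt (T - t) - c * (-1 / (2 * Real.sqrt (T - t)))) / Real.sqrt (T - t) ^ 2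
        / (Real.exp 1 + c / Real.sqrt (T - t))) t := by
    unfold Lfun; exact h4.log hE
  have h6 := h5.rpow_const (p := -ε) (Or.inl (Lfun_pos hc ht).ne')
  exact h6.const_mul (-(ε⁻¹))

/-- closed form of the derivative. -/
theorem Dfun_eq {ε c T t : ℝ} (hε : ε ≠ 0) (ht : t < T) :
    Dfun ε c T t = c / (2 * Real.sqrt (T - t) ^ 3 * (Real.exp 1 + c / Real.sqrt (T - t)))
      * Lfun c T t ^ (-ε - 1) := by
  have hs : 0 < Real.sqrt (T - t) := Real.sqrt_pos.mpr (by linarith)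
  have hs' : Real.sqrt (T - t) ≠ 0 := hs.ne'
  unfold Dfun
  field_simp
  ring

theorem Dfun_nonneg {ε c T t : ℝ} (hε : ε ≠ 0) (hc : 0 ≤ c) (ht : t < T) : 0 ≤ Dfun ε c T t := by
  rw [Dfun_eq hε ht]
  have hs : 0 < Real.sqrt (T - t) := Real.sqrt_pos.mpr (by linarith)
  have hL : 0 < Lfun c T t := Lfun_pos hc ht
  positivity

/-- Domination: along the envelope `y = c/√(T-t)`, `0 < t < T`,
`phi ε y ≤ K · Dfun` with `K = 2c(e√T + c)`. -/
theorem phi_le_K_Dfun {ε c T t : ℝ} (hε : 0 < ε) (hc : 0 < c) (ht : t ∈ Ioo 0 T) :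
    phi ε (c / Real.sqrt (T - t)) ≤ (2 * c * (Real.exp 1 * Real.sqrt T + c)) * Dfun ε c T t := by
  have htT : t < T := ht.2
  have hs : 0 < Real.sqrt (T - t) := Real.sqrt_pos.mpr (by linarith)
  have hsle : Real.sqrt (T - t) ≤ Real.sqrt T := Real.sqrt_le_sqrt (by linarith [ht.1])
  have hL : 0 < Lfun c T t := Lfun_pos hc.le htT
  have hE : 0 < Real.exp 1 + c / Real.sqrt (T - t) := by positivity
  rw [Dfun_eq hε.ne' htT]
  -- rewrite L^(-ε-1) = (L^(1+ε))⁻¹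
  have hneg : Lfun c T t ^ (-ε - 1) = (Lfun c T t ^ (1 + ε))⁻¹ := by
    rw [show (-ε - 1) = -(1 + ε) by ring, Real.rpow_neg hL.le]
  rw [hneg]
  have hM : 0 < Lfun c T t ^ (1 + ε) := Real.rpow_pos_of_pos hL _
  -- phi as product with the same inverse
  have hphi : phi ε (c / Real.sqrt (T - t)) = (c / Real.sqrt (T - t)) ^ 2 * (Lfun c T t ^ (1 + ε))⁻¹ := by
    unfold phi Lfun; rw [div_eq_mul_inv]
  rw [hphi, ← mul_assoc]
  refine mul_le_mul_of_nonneg_right ?_ (inv_nonneg.mpr hM.le)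
  -- core inequality: (c/s)^2 ≤ K * (c / (2 s^3 E))
  set s := Real.sqrt (T - t) with hs_def
  have hden : 0 < 2 * s ^ 3 * (Real.exp 1 + c / s) := by positivity
  rw [show 2 * c * (Real.exp 1 * Real.sqrt T + c) * (c / (2 * s ^ 3 * (Real.exp 1 + c / s)))
      = 2 * c * (Real.exp 1 * Real.sqrt T + c) * c / (2 * s ^ 3 * (Real.exp 1 + c / s)) by ring]
  rw [le_div_iff₀ hden]
  have expand : (c / s) ^ 2 * (2 * s ^ 3 * (Real.exp 1 + c / s))
      = 2 * c ^ 2 * Real.exp 1 * s + 2 * c ^ 3 := by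
    field_simp
  rw [expand]
  have hK : 2 * c * (Real.exp 1 * Real.sqrt T + c) * c
      = 2 * c ^ 2 * Real.exp 1 * Real.sqrt T + 2 * c ^ 3 := by ring
  rw [hK]
  have h2 : 0 ≤ 2 * c ^ 2 * Real.exp 1 := by positivity
  nlinarith [mul_le_mul_of_nonneg_left hsle h2]

/-- The limit at the blow-up time: `-(ε⁻¹) L^{-ε} → 0` as `t ↑ T` (for `c > 0`). -/
theorem tendsto_G_zero {ε c T : ℝ} (hε : 0 < ε) (hc : 0 < c) :
    Tendsto (fun t => -(ε⁻¹) * Lfun c T t ^ (-ε)) (𝓝[<] T) (𝓝 0) := by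
  have h_sub0 : Tendsto (fun t => T - t) (𝓝[<] T) (𝓝 0) := by
    have : Tendsto (fun t => T - t) (𝓝 T) (𝓝 (T - T)) :=
      (continuous_const.sub continuous_id).tendsto T
    rw [sub_self] at this
    exact this.mono_left nhdsWithin_le_nhds
  have h_sqrt0 : Tendsto (fun t => Real.sqrt (T - t)) (𝓝[<] T) (𝓝 0) := by
    have := (Real.continuous_sqrt.tendsto 0).comp h_sub0
    rw [Real.sqrt_zero] at this
    exact this
  have h_sqrt : Tendsto (fun t => Real.sqrt (T - t)) (𝓝[<] T) (𝓝[>] 0) := by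
    refine tendsto_nhdsWithin_iff.mpr ⟨h_sqrt0, ?_⟩
    exact eventually_nhdsWithin_of_forall fun _t ht => Real.sqrt_pos.mpr (by simpa using ht)
  have h_inv : Tendsto (fun t => (Real.sqrt (T - t))⁻¹) (𝓝[<] T) atTop :=
    tendsto_inv_nhdsGT_zero.comp h_sqrt
  have h_div : Tendsto (fun t => c / Real.sqrt (T - t)) (𝓝[<] T) atTop := by
    have := h_inv.const_mul_atTop hc
    exact this.congr fun t => (div_eq_mul_inv _ _).symm
  have h_add : Tendsto (fun t => Real.exp 1 + c / Real.sqrt (T - t)) (𝓝[<] T) atTop :=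
    tendsto_atTop_add_const_left _ _ h_div
  have h_log : Tendsto (fun t => Lfun c T t) (𝓝[<] T) atTop := by
    unfold Lfun; exact Real.tendsto_log_atTop.comp h_add
  have h_rpow : Tendsto (fun t => Lfun c T t ^ (-ε)) (𝓝[<] T) (𝓝 0) :=
    (tendsto_rpow_neg_atTop hε).comp h_log
  simpa using h_rpow.const_mul (-(ε⁻¹))

/-- The piecewise antiderivative, continuous on `[0,T]`. -/
noncomputable def Gfun (ε c T t : ℝ) : ℝ := if t < T then -(ε⁻¹) * Lfun c T t ^ (-ε) else 0

theorem hasDerivAt_Gfun {ε c T t : ℝ} (hc : 0 ≤ c) (ht : t < T) :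
    HasDerivAt (Gfun ε c T) (Dfun ε c T t) t := by
  refine (hasDerivAt_G (ε := ε) hc ht).congr_of_eventuallyEq ?_
  have : ∀ᶠ x in 𝓝 t, x < T := Iio_mem_nhds ht
  filter_upwards [this] with x hx
  unfold Gfun; rw [if_pos hx]

theorem continuousOn_Gfun {ε c T : ℝ} (hε : 0 < ε) (hc : 0 < c) (hT : 0 < T) :
    ContinuousOn (Gfun ε c T) (Icc 0 T) := by
  intro x hx
  by_cases hxT : x < T
  · exact (hasDerivAt_Gfun (ε := ε) hc.le hxT).continuousAt.continuousWithinAt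
  · have hx' : x = T := le_antisymm hx.2 (not_lt.mp hxT)
    subst hx'
    have hIio : ContinuousWithinAt (Gfun ε c x) (Iio x) x := by
      have hG0 : Gfun ε c x x = 0 := by unfold Gfun; rw [if_neg (lt_irrefl x)]
      show Tendsto (Gfun ε c x) (𝓝[<] x) (𝓝 (Gfun ε c x x))
      rw [hG0]
      refine (tendsto_G_zero (T := x) hε hc).congr' ?_
      exact eventually_nhdsWithin_of_forall fun t ht => by
        unfold Gfun; rw [if_pos (show t < x from ht)]
    have hIic : ContinuousWithinAt (Gfun ε c x) (Iic x) x :=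
      continuousWithinAt_Iio_iff_Iic.mp hIio
    exact hIic.mono Icc_subset_Iic_self

theorem integrableOn_Dfun {ε c T : ℝ} (hε : 0 < ε) (hc : 0 < c) (hT : 0 < T) :
    IntegrableOn (Dfun ε c T) (Ioc 0 T) :=
  intervalIntegral.integrableOn_deriv_of_nonneg (continuousOn_Gfun hε hc hT)
    (fun _ ht => hasDerivAt_Gfun hc.le ht.2) (fun _ ht => Dfun_nonneg hε.ne' hc.le ht.2)

theorem integrableOn_phi_envelope {ε : ℝ} (hε : 0 < ε) (C T : ℝ) (hT : 0 < T) :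
    IntegrableOn (fun t => phi ε (|C| / Real.sqrt (T - t))) (Ioo 0 T) := by
  rcases eq_or_ne C 0 with hC | hC
  · subst hC
    have : (fun t : ℝ => phi ε (|(0:ℝ)| / Real.sqrt (T - t))) = fun _ => 0 := by
      funext t; simp [phi]
    rw [this]; exact integrableOn_zero
  have hc : 0 < |C| := abs_pos.mpr hC
  set K := 2 * |C| * (Real.exp 1 * Real.sqrt T + |C|) with hK
  have hD : IntegrableOn (fun t => K * Dfun ε |C| T t) (Ioo 0 T) :=
    ((integrableOn_Dfun hε hc hT).mono_set Ioo_subset_Ioc_self).const_mul K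
  refine Integrable.mono' hD ?_ ?_
  · have hm : Measurable fun t => phi ε (|C| / Real.sqrt (T - t)) := by
      unfold phi; fun_prop
    exact hm.aestronglyMeasurable
  · refine ae_restrict_of_forall_mem measurableSet_Ioo fun t ht => ?_
    rw [Real.norm_of_nonneg (phi_nonneg (div_nonneg hc.le (Real.sqrt_nonneg _)))]
    exact phi_le_K_Dfun hε hc ht

/-- **The calculus fact**: the Osgood majorant is integrable on `(0,T)` for every `ε > 0`. -/
theorem osgoodModelIntegrable {ε : ℝ} (hε : 0 < ε) : OsgoodModelIntegrable ε := by
  intro C T hT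
  unfold osgoodMajorant
  exact (integrableOn_inv_sqrt C T hT).add ((integrableOn_phi_envelope hε C T hT).const_mul _)


/-! ### Unconditional consequences (ε > 0) -/

/-- **Enemy placement (theorem)**: every sup-rate Type-I blow-up lies on the Osgood-convergent side. -/
theorem typeIOnOsgoodLine {ε : ℝ} (hε : 0 < ε) : TypeIOnOsgoodLine ε :=
  typeIOnOsgoodLine_of_model hε.le (osgoodModelIntegrable hε)

/-- **Barrier pin (theorem)**: vendored `AveragedTypeIBlowup` ⇒ Osgood-majorised Tao-class blow-up. -/
theorem osgoodLineAbstractPin {ε : ℝ} (hε : 0 < ε) : OsgoodLineAbstractPin ε :=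
  osgoodLineAbstractPin_of_model hε.le (osgoodModelIntegrable hε)

/-- **`OsgoodSerrinAveragedFailure ε` holds outright for every `ε > 0`** (uses the tree theorem
`Theorems.PerpetualPumpAveragedTypeIBlowup.AveragedTypeIBlowup_of`, route PerpetualPump, item 1835):
in Tao's symmetric averaged class with cancellation there is a Schwartz div-free datum and a mild solution
blowing up at a finite time `T` (no mild extension) whose Osgood-damped Serrin density
`‖u(t)‖²_∞ / (log(e+‖u(t)‖_∞))^{1+ε}` is majorised by an `L¹(0,T)` function. Hence NO Osgood-convergent
log-damped `(2,∞)` Prodi–Serrin criterion can be proved by averaging-insensitive means. -/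
theorem osgoodSerrinAveragedFailure {ε : ℝ} (hε : 0 < ε) : OsgoodSerrinAveragedFailure ε :=
  osgoodLineAbstractPin hε Theorems.PerpetualPumpAveragedTypeIBlowup.AveragedTypeIBlowup_of

/-- The averaged-class analogue of `OsgoodSerrin ε`, phrased as a CONTINUATION CRITERION for the averaged
equation with datum `𝒜`: every mild solution on `[0,T)` from Schwartz div-free data whose Osgood-damped density
admits an `L¹(0,T)` majorant extends as a mild solution past `T`. (For true NS this is the open input of row 23.) -/
def AveragedOsgoodSerrinCriterion (ε : ℝ) (𝒜 : Tao2016.AveragingDatum) : Prop :=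
  ∀ (u₀ : SchwartzMap E3 E3), VectorCalculus.IsDivFree ⇑u₀ → ∀ T : ℝ, 0 < T →
    ∀ u : ℝ → Tao2016.L2C, 𝒜.IsMildSolution (Tao2016.schwartzL2 u₀) (Ico 0 T) u →
      (∃ g : ℝ → ℝ, IntegrableOn g (Ioo 0 T) ∧
          ∀ t ∈ Ico 0 T, phi ε (eLpNorm (u t) ⊤ volume).toReal ≤ g t) →
      ∃ T' : ℝ, T < T' ∧ ∃ v : ℝ → Tao2016.L2C,
        𝒜.IsMildSolution (Tao2016.schwartzL2 u₀) (Ico 0 T') v ∧ ∀ t ∈ Ico 0 T, v t = u t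

/-- **METHOD BARRIER (theorem)**: for every `ε > 0` there is a symmetric averaging datum with cancellation
(energy identity) for which the Osgood-convergent `(2,∞)` continuation criterion FAILS. Any proof of
`OsgoodSerrin ε` for true NS must therefore use structure of `B(u,u)` destroyed by Tao averaging. -/
theorem averagedOsgoodSerrinCriterion_fails {ε : ℝ} (hε : 0 < ε) :
    ∃ 𝒜 : Tao2016.AveragingDatum, 𝒜.IsSymmetric ∧ 𝒜.HasCancellation ∧
      ¬ AveragedOsgoodSerrinCriterion ε 𝒜 := by
  obtain ⟨𝒜, hs, hc, u₀, hdiv, T, hT, u, hmild, hno, g, hg, hbound⟩ := osgoodSerrinAveragedFailure hε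
  exact ⟨𝒜, hs, hc, fun H => hno (H u₀ hdiv T hT u hmild ⟨g, hg, hbound⟩)⟩

/-- **The single input alone decides 23843** (vacuously), for any `ε > 0`. -/
theorem scarEnvelopeTypeI_of_osgoodSerrin' {ε : ℝ} (hε : 0 < ε) (hO : OsgoodSerrin ε) :
    Summit.NavierStokesRegularity.NavierStokesRegularity.Theses.TypeIQuarterGate.ScarEnvelopeTypeI :=
  scarEnvelopeTypeI_of_osgoodSerrin ε hO (typeIOnOsgoodLine hε)

/-- **Why it is a costume**: the single input is Type-I EXCLUSION for the Leray–Hopf maximal smooth class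
(the wall statement itself, uniform in the Type-I constant), not a weakening of it. -/
theorem osgoodSerrin_excludes_typeI {ε : ℝ} (hε : 0 < ε) (hO : OsgoodSerrin ε) :
    ∀ (ν T : ℝ), 0 < ν → 0 < T → ∀ (u : ℝ → E3 → E3) (p : ℝ → E3 → ℝ),
      IsMaximalSmoothSolution ν 0 u p T → IsLerayHopfOn T ν 0 (u 0) u →
      HasRapidSpatialDecay (u 0) → ¬ IsTypeIBlowup u T := by
  intro ν T hν hT u p hmax hLH hdec hI
  exact hO ν T hν hT u p hmax hLH hdec (typeIOnOsgoodLine hε T u hT hI)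

end Summit.NavierStokesRegularity.NavierStokesRegularity.Cruxes.ScarEnvelopeTypeI.OsgoodLine
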